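import Mathlib
import Literature.NumberTheory.LFunctions.Zhang2022.TypedSection15B
import HarnessLib

/-!
# Zhang (2022) §15 p. 85, (15.15) ON THE SUPPORT OF `b`: the inline remark "`P₄/d > T`" is true where
# the leaf (15.17) uses it — typed reading `Eq15_15S` and the support lemma `b(n) = 0` for `n ≥ P₄/T`

Topic `Literature/NumberTheory/LFunctions/Zhang2022` (Landau–Siegel audit tree; verdict-neutral).
Y. Zhang, *Discrete mean estimates and the Landau–Siegel zero*, arXiv:2211.02515v1 (2022)
[Zhang2022LandauSiegel] — **an unrefereed manuscript under adjudication; the `def … : Prop` below is a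
CLAIM-VARIANT (a reading of display (15.15)), STATED NOT ASSERTED; nothing here asserts or denies
Theorems 1–2.** Lane ZHANG-L, WP15 typer file, for the LEAF-RISK leaf `h15_17 : Typed.Section15B.Eq15_17 c′
Typed.Section15A.bChi` ((15.17) ⇐ (15.11) + (15.15)) and GAP row G-L4t2-1 (siegel-zhang plan/GAP-DIGEST
row 16): the printed lead-in of (15.15) (§15 p. 85, tex L4217)

> Assume `dl < PT⁻²`, and `(dl, D) = 1`. Note that `P₄/d > T`.

is false as a consequence of `dl < PT⁻²` alone (`P₄ = PT⁻²t₀` gives only `P₄/d > t₀l`; typed AS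
PRINTED as `Typed.Section15B.Inline15_P4d`, flagged), and the Lemma-8.4-type contour shift behind
(15.15) needs the length `P₄/d > T` to save `exp(−c𝓛^{1/10})`. OBSERVATION (kernel-checked in the sibling theorems file `Section15BcoefSupport`): the
coefficients `b(n)` are supported far inside the printed range — `b = u ⋆ v` with `u` supported on
`n < P^{1/2}` and `v` on `n < max(P₂, P₃)` (`P₂ = P^{1/2}T⁻¹⁰`, `P₃ = P^{0.498}`; (12.2), (8.6)), so
`b(n) = 0` for `n ≥ P^{1/2}max(P₂,P₃)`, and `P^{1/2}max(P₂,P₃) ≤ P₄/T = Pt₀T⁻³` once `𝓛 ≥ 3`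
(`bcoef_eq_zero_of_P4_div_bigT_le`). Hence for every `(d,l)` that (15.17) actually sums (`b(dl) ≠ 0`)
one has `dl < P₄/T`, so `P₄/d > T·l ≥ T` (`bigT_lt_P4_div_of_bcoef_ne_zero`): the inline remark holds ON
THE SUPPORT, and (15.15) is only ever consumed there. `Eq15_15S` = (15.15) with the extra hypothesis
`T < P₄/d` (weaker than the typed `Eq15_15`: drop the extra hypothesis); it is the reading a closer of
h15_17 can use in place of `Eq15_15` with NO loss (assembly (15.11)+(15.15S) ⇒ (15.17) over
`b(dl) ≠ 0`). Not a re-type of the leaf (h15_17 itself is unchanged). No instances, no notation;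
nothing banked is restated.

## References
* Y. Zhang, arXiv:2211.02515v1 (2022), §15 p. 85 (15.15) (tex L4217–L4225); §15 (15.1)–(15.2) p. 79;
  §8 (8.6); §6 p. 12 (`P₄ = PT⁻²t₀`); §2 (2.21) (`P₂, P₃`). [cite: Zhang2022LandauSiegel, §15 (15.15) p. 85]
-/

noncomputable section

open Complex Real ComplexConjugate

/-! ## (15.15) on the support: `Eq15_15S` -/

namespace Literature.NumberTheory.LFunctions.Zhang2022.Typed.Section15B

open Literature.NumberTheory.LFunctions.Zhang2022.Typed.Section15A

/-- **(15.15) ON THE SUPPORT OF `b`** (§15 p. 85, tex L4218; CLAIM-VARIANT of `Eq15_15`): "Assume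
`dl < PT⁻²`, `(dl,D) = 1`" AND `P₄/d > T` (the inline remark, here a HYPOTHESIS — automatic whenever
`b(dl) ≠ 0`, `Skeleton.bigT_lt_P4_div_of_bcoef_ne_zero`). "In a way similar to the proof of Lemma 8.4,
we deduce that `𝒟₁(d,l) = λ₁(d)Σ_{j≤3} ℛ_{1j}d^{β_j}ℳ₁(d,l;1−β_j) + O(ε₁)`" (`ε₁ = exp{−c𝓛^{1/10}}`). Weaker
than the typed `Eq15_15` (`eq15_15S_of_eq15_15`) and the reading a closer of h15_17 can consume
((15.11) sums `b(dl)·…·𝒟₁(d,l)`). [cite: Zhang2022LandauSiegel, §15 (15.15) p. 85] -/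
def Eq15_15S (c' : ℝ) : Prop :=
  ∃ c : ℝ, 0 < c ∧ ∃ C : ℝ, Skeleton.ForAllLarge fun D _ χ => Skeleton.AssumptionA D χ →
    ∀ d l : ℕ, 1 ≤ d → 1 ≤ l → ((d * l : ℕ) : ℝ) < Skeleton.bigP D / Skeleton.bigT D ^ 2 →
      Skeleton.bigT D < Skeleton.P4 D / d → Nat.Coprime (d * l) D →
        ‖calD1 c' χ d l -
            lam1 c' χ d 1 * ∑ j ∈ ({1, 2, 3} : Finset ℕ),
              calR1 c' χ j * (d : ℂ) ^ Skeleton.betaJ c' D j *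
                calM1 c' χ d l (1 - Skeleton.betaJ c' D j)‖ ≤
          C * Real.exp (-c * Skeleton.ell D ^ (1 / 10 : ℝ))

end Literature.NumberTheory.LFunctions.Zhang2022.Typed.Section15B
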